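import Summits.QuantumFields.BalabanUV.T4Continuum.Support.NE7DecompOfTopNormalised
import Summits.QuantumFields.BalabanUV.T4Continuum.Support.NE3ClassRadiusFamily
import HarnessLib

/-!
# Support | NE7 (gen 98, THE PER-PAIR BINDER OVER ROAD-Γ′ AT `d = 4`, `L = 2`): `hdecomp_body_of_topNormalised` — the BODY of the per-pair binder `hdecomp♭` of
# `NE7HintOfSliceNormalisationSU2Dec.hint_SU2_of_decomposition` is DISCHARGED from TWO named suppliers: (A) a TOP-NORMALISED representative of the pair (corner-trivial unitary gauge `u`, `U′^{u} = U_s·e^{X}`, trivial accumulated top frame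
# `v_{k+1} ≡ 1`, `sup‖X‖·M ≤ α̂`) and (B) the three k-free MASSES `(m₂, p₂, m₁)` of leaf-02's slice-correcting generator of the tangent residual — all regime binders of ROAD-Γ′'s
# S4∕S5 files being discharged here at `d = 4`, `L = 2` from `ε ≤ ε₀` and one explicit k-free line on `α̂`

Cell `pub-balaban`, rung (B)+1 sub-cell t4, lineage `b2b-balaban-t4-ne7-p1` (CRUX PROVER NE7 #1 = OWNER of row NE7), generation 98; memo `t4/b2b-balaban-t4-ne7-p1-g98/ROAD-G98.md` §3.
Over this generation's `NE7DecompOfTopNormalised.decomp_of_topNormalised` (the `hdecomp♭` split and its two letters from a top-normalised representative modulo three masses), with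
row NE3's class-radius family `NE3ClassRadiusFamily.levelSmall_family_d4_L2 ∕ radIter_radSum_le_of_small` and `NE3RightInverseLetters.theta_lt_one_of_loc` for the regime binders.
(The END re-issue `hint_SU2_of_topNormalised`, which threads this body through `hint_SU2_of_decomposition`'s quantifiers, is the sequel file `NE7HintOfTopNormalisedSU2`.)

WHY.  After gen 98 the per-pair binder reads: `hdecomp♭ ⇐ (A) ∧ (B)` (memo §0).  THIS FILE makes that implication a kernel theorem in the END's own currency (`d = 4`, `L = 2`, SU(2),
`x = ε∕M²`, `M = 2^{k+1}`): every regime hypothesis of the S4∕S5 files (`LevelSmall`, `cruxC∕thetaLoc` lines, `α₀ := 2ε` with `C0∕c2'` lines and `pdev < α₀∕M²`, the Prop-4 exponential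
line, `c3`, `hK`, the ℓ¹ tower line `hS1`, `44dL·Mb ≤ 1`, the geometric ceilings `Γ₁ = 2`, `Γ₂ = 1`, `Γ₃ = Γ₄ = 4∕3`) is discharged from `ε ≤ ε₀` (an explicit positive minimum) and ONE
four explicit k-free lines on `α̂`; the letters' constants become k-free functions `ν(α̂, ε, m₂, p₂)`, `κ(ε, m₁)` and the END's `ν ≤ ν̂`, `κ ≤ κ̂` are two displayed k-free lines.
WHAT ([folklore]; 0 def, 0 sorry).  §1 numeric lemmas at `d = 4`, `L = 2` (`pdev_le_of_smallField'`, `ceiling_one … ceiling_four`, `radius_identities`, `levelSmall_d4_L2`, `radSum_d4_L2_le`,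
`exp_line`); §2 **`hdecomp_body_of_topNormalised`** (the per-pair binder body from (A) ∧ (B) at fixed `ε`, every regime binder of the S4∕S5 files discharged).
HONEST FRAMING (page 1): composition and real arithmetic over landed kernel theorems; (A) (S1 + S2 of ROAD-Γ′: the sup-normalised slice∕top-frame gauge — [Balaban1985RegularSpaces]
Sects. D–E TYPE) and (B) (the Green's-function letter (G-ℓ¹) and the S1 structure, memo §2) are HYPOTHESES asserted for nothing; nothing of Bałaban's asserted; NE7 NOT PROVED; spine 0∕9;
finite T⁴ rung (B)+1 — NOT infinite volume, NOT mass gap, NOT `BetaPertH`, NOT Clay.  Continuum YM on T⁴ ⇐ BetaPertH ∧ nine spine estimates (0/9 proved); BetaPertH ⇐ (D1) ∧ (D4) ∧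
CAP+tail; G-an2-4 gates asym, D1 and NE2/3/4.
-/

set_option autoImplicit false

open scoped BigOperators Matrix Matrix.Norms.L2Operator Topology
open NormedSpace Finset Set Filter

namespace Summit.QuantumFields.BalabanUV.T4Continuum.NE7HdecompOfTopNormalised

open Literature.MathematicalPhysics.QuantumFieldTheory.Balaban1983to89
open B7Prop1Explicit B7Prop2Explicit B7Prop3Flat MatrixLog UnitaryModel MatrixNorms
open T4AveragingDeficitWall (Ad IsUnitaryCfg IsSkewDir SmallField vary curl curlSq dirSq dirL1)
open T4AveragingDeficitWallBoundary (IsPeriodicCfg periodBox)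
open AveragingDeficitPeriodicCounting (IsPeriodicDir)
open AveragingDeficitMultiLevelPrep (LevelSmall tower TangentIter cavgIter radIter)
open AveragingDeficitTwoLevelPrep (twoLevelSmall)
open AveragingDeficitMultiLevelBridge (cavgIter_eq_avgIter)
open ReplicationRightInverseBound (radSum)
open BlockAverageVaryHolo (nbRad)
open NE3CovariantLineSumsError (Csup Csup_nonneg)
open ShellMeasureAverageProp4General (C1cov C1cov_pos)
open MinimalActionLevels (perWin)
open MinimalActionRate (sfClass)
open NE3TangentCovariantTower (dirIter QbarIter framePotW)
open B7Eq92Concrete (vcov)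
open NE3.PairLandauB8Avg (relPert)
open BlockAveragePushDirGauge (gaugeDir)
open NE3CornerSpikes (spikeW)
open NE3QbarIterCovLiftPrep (cruxC)
open NE3SmoothRightInverseW (rightInvW)
open NE3RightInverseSolveLetters (thetaLoc thetaLoc_nonneg cruxC_le_thetaLoc)
open NE3RightInverseL2Letter (l2C l2C_nonneg)
open NE3HatInvCurlLetters (curl2C curl1C curl2C_nonneg curl1C_nonneg)
open NE3RightInverseLetters (theta_lt_one_of_loc)
open NE3EnergyShapes (IsUnitarySite IsPeriodicSite)
open NE3EnergyWeightedShapes (energyNormW energyNormW_nonneg)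
open NE3FrameFreeSliceW (frameFreeBlockLandauW)
open NE3ClassRadiusFamily (levelSmall_family_d4_L2 radIter_radSum_le_of_small)
open NE7DecompOfTopNormalised (decomp_of_topNormalised)

noncomputable section

variable {n : Type} [Fintype n] [DecidableEq n]

/-! ## §1 Numeric lemmas at `d = 4`, `L = 2` -/

/-- `SmallField V a`, `0 ≤ a` ⟹ `pdev V ≤ a` (the diagonal words are trivial; twin of `NE3.SupplierB8SfClassPrep.pdev_le_of_smallField`, re-proved to keep the layering). [folklore] -/
theorem pdev_le_of_smallField' {d : ℕ} {V : Site d → Fin d → (Matrix n n ℂ)ˣ} {a : ℝ} (ha : 0 ≤ a) (hV : SmallField V a) : pdev V ≤ a := by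
  unfold pdev
  refine Real.iSup_le (fun p => ?_) ha
  rcases eq_or_ne p.2.1 p.2.2 with h | h
  · have h1 : hol V p.1 (plaqWord p.2.1 p.2.2) = 1 := by
      rw [h, B7Prop1Local.hol_plaqWord_eq, mul_inv_cancel_right, mul_inv_cancel]
    rw [h1, Units.val_one, sub_self, norm_zero]
    exact ha
  · exact hV p.1 p.2.1 p.2.2 h

/-- `Γ₁ = 2` at `L = 2`, `d = 4`: `Σ_{m<k+1} 2^m·(2²∕2⁴)^m = Σ (1∕2)^m ≤ 2`. [folklore] -/
theorem ceiling_one (k : ℕ) : ∑ m ∈ range (k + 1), ((2 : ℕ) : ℝ) ^ m * (((2 : ℕ) : ℝ) ^ 2 / ((2 : ℕ) : ℝ) ^ 4) ^ m ≤ 2 := by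
  have e : ∀ m : ℕ, ((2 : ℕ) : ℝ) ^ m * (((2 : ℕ) : ℝ) ^ 2 / ((2 : ℕ) : ℝ) ^ 4) ^ m = (1 / 2 : ℝ) ^ m := by
    intro m; rw [← mul_pow]; norm_num
  simp_rw [e]
  have h := geom_sum_Ico_le_of_lt_one (m := 0) (n := k + 1) (x := (1 / 2 : ℝ)) (by norm_num) (by norm_num)
  simp only [Finset.range_eq_Ico] at h ⊢
  calc ∑ i ∈ Ico 0 (k + 1), (1 / 2 : ℝ) ^ i ≤ (1 / 2 : ℝ) ^ 0 / (1 - 1 / 2) := h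
    _ = 2 := by norm_num

/-- `Γ₂ = 1` at `L = 2`, `d = 4`: `(k+1)·Σ_{i<k} (2²·(2²∕2⁴))^i = (k+1)k ≤ (2^{k+1})²`. [folklore] -/
theorem ceiling_two (k : ℕ) :
    ((k : ℝ) + 1) * ∑ i ∈ range k, (((2 : ℕ) : ℝ) ^ 2 * (((2 : ℕ) : ℝ) ^ 2 / ((2 : ℕ) : ℝ) ^ 4)) ^ i ≤ 1 * (((2 : ℕ) : ℝ) ^ (k + 1)) ^ 2 := by
  have e : (((2 : ℕ) : ℝ) ^ 2 * (((2 : ℕ) : ℝ) ^ 2 / ((2 : ℕ) : ℝ) ^ 4)) = 1 := by norm_num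
  simp only [e, one_pow, Finset.sum_const, Finset.card_range, nsmul_eq_mul, mul_one, one_mul]
  have h1 : (k : ℝ) + 1 ≤ (2 : ℝ) ^ (k + 1) := by
    have := Nat.lt_two_pow_self (n := k + 1)
    exact_mod_cast this.le
  have h2 : (k : ℝ) ≤ (2 : ℝ) ^ (k + 1) := by
    have := Nat.lt_two_pow_self (n := k)
    have h : (k : ℝ) ≤ (2 : ℝ) ^ k := by exact_mod_cast this.le
    exact h.trans (pow_le_pow_right₀ (by norm_num) (Nat.le_succ k))
  have hk0 : (0 : ℝ) ≤ k := by positivity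
  push_cast
  calc ((k : ℝ) + 1) * k ≤ (2 : ℝ) ^ (k + 1) * (2 : ℝ) ^ (k + 1) := mul_le_mul h1 h2 hk0 (by positivity)
    _ = ((2 : ℝ) ^ (k + 1)) ^ 2 := by ring

/-- `Γ₃ = 4∕3` at `L = 2`, `d = 4`: `Σ_{i<k} ((2∕2⁴)·2)^i = Σ (1∕4)^i ≤ 4∕3`. [folklore] -/
theorem ceiling_three (k : ℕ) : ∑ i ∈ range k, ((((2 : ℕ) : ℝ) / ((2 : ℕ) : ℝ) ^ 4) * ((2 : ℕ) : ℝ)) ^ i ≤ 4 / 3 := by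
  have e : ((((2 : ℕ) : ℝ) / ((2 : ℕ) : ℝ) ^ 4) * ((2 : ℕ) : ℝ)) = 1 / 4 := by norm_num
  rw [e]
  have h := geom_sum_Ico_le_of_lt_one (m := 0) (n := k) (x := (1 / 4 : ℝ)) (by norm_num) (by norm_num)
  simp only [Finset.range_eq_Ico] at h ⊢
  calc ∑ i ∈ Ico 0 k, (1 / 4 : ℝ) ^ i ≤ (1 / 4 : ℝ) ^ 0 / (1 - 1 / 4) := h
    _ = 4 / 3 := by norm_num

/-- `Γ₄ = 4∕3` at `L = 2`, `d = 4`: `Σ_{m<k+1} (2²∕2⁴)^m ≤ 4∕3`. [folklore] -/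
theorem ceiling_four (k : ℕ) : ∑ m ∈ range (k + 1), (((2 : ℕ) : ℝ) ^ 2 / ((2 : ℕ) : ℝ) ^ 4) ^ m ≤ 4 / 3 := by
  have e : (((2 : ℕ) : ℝ) ^ 2 / ((2 : ℕ) : ℝ) ^ 4) = 1 / 4 := by norm_num
  rw [e]
  have h := geom_sum_Ico_le_of_lt_one (m := 0) (n := k + 1) (x := (1 / 4 : ℝ)) (by norm_num) (by norm_num)
  simp only [Finset.range_eq_Ico] at h ⊢
  calc ∑ i ∈ Ico 0 (k + 1), (1 / 4 : ℝ) ^ i ≤ (1 / 4 : ℝ) ^ 0 / (1 - 1 / 4) := h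
    _ = 4 / 3 := by norm_num

/-- The radius identity at `L = 2`: `(2²)^k·(ε∕(2^{k+1})²) = ε∕4` and `(2^{k+1})²·(ε∕(2^{k+1})²) = ε`. [folklore] -/
theorem radius_identities (k : ℕ) (ε : ℝ) :
    (((2 : ℕ) : ℝ) ^ 2) ^ k * (ε / (((2 : ℕ) : ℝ) ^ (k + 1)) ^ 2) = ε / 4 ∧ (((2 : ℕ) : ℝ) ^ (k + 1)) ^ 2 * (ε / (((2 : ℕ) : ℝ) ^ (k + 1)) ^ 2) = ε := by
  have hM : (0 : ℝ) < ((2 : ℕ) : ℝ) ^ (k + 1) := by positivity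
  have hM2 : (((2 : ℕ) : ℝ) ^ (k + 1)) ^ 2 ≠ 0 := by positivity
  constructor
  · have e : (((2 : ℕ) : ℝ) ^ (k + 1)) ^ 2 = 4 * (((2 : ℕ) : ℝ) ^ 2) ^ k := by
      rw [← pow_mul, ← pow_mul, show (k + 1) * 2 = 2 * k + 2 by ring, pow_add]; push_cast; ring
    rw [e]; field_simp
  · field_simp

/-- `LevelSmall 4 2 k (ε∕(2^{k+1})²)` for `0 ≤ ε ≤ 10⁻¹¹` (row NE3's class-radius family; level `0` directly). [folklore] -/
theorem levelSmall_d4_L2 {ε : ℝ} (hε : 0 ≤ ε) (hε' : ε ≤ 1 / 10 ^ 11) (k : ℕ) : LevelSmall 4 2 k (ε / (((2 : ℕ) : ℝ) ^ (k + 1)) ^ 2) := by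
  cases k with
  | zero =>
      show twoLevelSmall 4 2 * (ε / (((2 : ℕ) : ℝ) ^ (0 + 1)) ^ 2) ≤ 1
      unfold twoLevelSmall
      norm_num at hε' ⊢
      nlinarith
  | succ j =>
      have h := levelSmall_family_d4_L2 hε hε' j
      have e : (j + 1 + 1) = (j + 2) := by ring
      rw [e]; exact h

/-- The ℓ¹ tower radius at `d = 4`, `L = 2`: `radSum 4 2 k (ε∕(2^{k+1})²) ≤ (8∕3)·(ε∕4)` for `0 ≤ ε ≤ 10⁻¹¹`. [folklore] -/
theorem radSum_d4_L2_le {ε : ℝ} (hε : 0 ≤ ε) (hε' : ε ≤ 1 / 10 ^ 11) (k : ℕ) : radSum 4 2 k (ε / (((2 : ℕ) : ℝ) ^ (k + 1)) ^ 2) ≤ 8 / 3 * (ε / 4) := by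
  have hx : 0 ≤ ε / (((2 : ℕ) : ℝ) ^ (k + 1)) ^ 2 := by positivity
  have hid := (radius_identities k ε).1
  have h := (radIter_radSum_le_of_small (d := 4) (L := 2) (by norm_num) k hx ?_).2
  · rw [hid] at h; exact h
  · rw [hid]; norm_num at hε' ⊢; nlinarith

/-- The Prop-4 exponential line: for `0 ≤ s ≤ 1∕10`, `0 ≤ t ≤ 1∕10`, `exp(s)·(1 + t) ≤ 2`. [folklore] -/
theorem exp_line {s t : ℝ} (hs0 : 0 ≤ s) (hs : s ≤ 1 / 10) (ht0 : 0 ≤ t) (ht : t ≤ 1 / 10) : Real.exp s * (1 + t) ≤ 2 := by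
  have h1 : Real.exp s ≤ 1 / (1 - s) := Real.exp_bound_div_one_sub_of_interval hs0 (by linarith)
  have h2 : 1 / (1 - s) ≤ 10 / 9 := by
    rw [div_le_div_iff₀ (by linarith) (by norm_num)]; linarith
  have h3 : Real.exp s ≤ 10 / 9 := h1.trans h2
  have h4 : 1 + t ≤ 11 / 10 := by linarith
  calc Real.exp s * (1 + t) ≤ 10 / 9 * (11 / 10) := mul_le_mul h3 h4 (by linarith) (by norm_num)
    _ ≤ 2 := by norm_num

/-! ## §2 The `hdecomp♭` body from a top-normalised representative and the three masses, at `d = 4`, `L = 2` -/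

/-- **THE PER-PAIR BINDER `hdecomp♭` FROM (A) A TOP-NORMALISED REPRESENTATIVE AND (B) THE THREE MASSES** (`d = 4`, `L = 2`, level `k+1`, `M = 2^{k+1}`, `x = ε∕M²`).  ε-LINES: `ε ≤ 10⁻¹¹`,
`thetaLoc·ε < 1`, `C0·4ε ≤ 1∕3`, `16ε ≤ c2'`, the ℓ¹ tower line at radius `(8∕3)(ε∕4)`; α̂-LINES: `8·131072·25·α̂ ≤ 1∕10`, `4α̂ ≤ c3`, the `hK` line, `352α̂ ≤ 1`.  CLASS DATA: `U_s` unitary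
`(N·M)`-periodic with `SmallField U_s x`, common `(k+1)`-fold average `D` of `U_s` and `U′`.  (A): a unitary CORNER-TRIVIAL gauge `u`, a skew `(N·M)`-periodic `X` with `sup‖X‖ ≤ b`, `M·b ≤ α̂`,
`U′^{u} = U_s·e^{X}` and TRIVIAL ACCUMULATED TOP FRAME `v_{k+1} ≡ 1`.  (B): the three masses `(m₂, p₂, m₁)` of every corner-trivial slice-correcting generator of the tangent residual (the
hypothesis `hμ` of `NE7DecompOfTopNormalised.decomp_of_topNormalised`, its proof arguments universally bound).  LINES ON THE CEILINGS: `ν(α̂, ε, m₂, p₂) ≤ ν̂`, `κ(ε, m₁) ≤ κ̂` (displayed).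
CONCLUSION: the body of `hdecomp♭` of `NE7HintOfSliceNormalisationSU2Dec.hint_SU2_of_decomposition` for this pair, with `α = b`. [folklore] -/
theorem hdecomp_body_of_topNormalised [Nonempty n] {N : ℕ} [NeZero N] (hN : 1 ≤ N) (k : ℕ) {ε : ℝ} (hε : 0 < ε)
    (hε11 : ε ≤ 1 / 10 ^ 11) (hεθ : thetaLoc 4 2 * ε < 1) (hεC0 : C0 4 * (2 * (2 * ε)) ≤ 1 / 3) (hεc2 : 4 * (2 * (2 * ε)) ≤ c2' 4 2)
    (hεS1 : 16 * (((4 : ℕ) : ℝ) + 1) * (((4 : ℕ) : ℝ) + 4) * ((2 : ℕ) : ℝ) ^ 2 * Csup 4 2 * (((4 : ℕ) : ℝ) * (2 * ((nbRad 4 2 : ℕ) : ℝ) + 1) ^ 4) * (8 / 3 * (ε / 4))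
      ≤ ((2 : ℕ) : ℝ) / ((2 : ℕ) : ℝ) ^ 4 / 2)
    {Us U' D : Site 4 → Fin 4 → (Matrix n n ℂ)ˣ} (hWu : IsUnitaryCfg Us) (hWP : IsPeriodicCfg Us ((N * 2 ^ (k + 1) : ℕ) : ℤ))
    (hWx : SmallField Us (ε / (((2 : ℕ) : ℝ) ^ (k + 1)) ^ 2)) (hA : avgIter 2 U' (k + 1) = D) (hW : avgIter 2 Us (k + 1) = D)
    {αh : ℝ} (hαh1 : 8 * (131072 * (((4 : ℕ) : ℝ) + 1) ^ 2) * αh ≤ 1 / 10) (hαh2 : 4 * αh ≤ c3 4 2)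
    (hαh3 : 16 * (C1cov 4 * ((2 : ℕ) : ℝ) ^ 2 * Real.sqrt (((4 : ℕ) : ℝ) * (2 * (2 * ((2 : ℕ) : ℝ)) + 1) ^ 4)) * αh ≤ Real.sqrt (((2 : ℕ) : ℝ) ^ 2 / ((2 : ℕ) : ℝ) ^ 4))
    (hαh4 : 44 * (((4 : ℕ) : ℝ) * ((2 : ℕ) : ℝ) * αh) ≤ 1)
    {u : Site 4 → (Matrix n n ℂ)ˣ} {X : Site 4 → Fin 4 → Matrix n n ℂ} {b : ℝ}
    (hu : IsUnitarySite u) (hcorner : ∀ z : Site 4, u ((((2 : ℕ) : ℤ) ^ (k + 1)) • z) = 1) (hXs : IsSkewDir X) (hXP : IsPeriodicDir X ((N * 2 ^ (k + 1) : ℕ) : ℤ))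
    (hb : 0 ≤ b) (hX : ∀ (y : Site 4) (κ : Fin 4), ‖X y κ‖ ≤ b) (hrep : gaugeAct u U' = vary Us X 1)
    (hv1 : ∀ z : Site 4, vcov 2 Us (relPert Us X) (k + 1) z = 1) (hbα : ((2 : ℕ) : ℝ) ^ (k + 1) * b ≤ αh)
    {m₂ p₂ m₁ : ℝ} (hm₂ : 0 ≤ m₂) (hp₂ : 0 ≤ p₂) (hm₁ : 0 ≤ m₁)
    (hμ : ∀ (hx0 : 0 ≤ ε / (((2 : ℕ) : ℝ) ^ (k + 1)) ^ 2) (hsm0 : LevelSmall 4 2 k (ε / (((2 : ℕ) : ℝ) ^ (k + 1)) ^ 2))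
        (hθ0 : cruxC 4 2 * ((((2 : ℕ) : ℝ) ^ (k + 1)) ^ 2 * (ε / (((2 : ℕ) : ℝ) ^ (k + 1)) ^ 2)) < 1)
        (hYs : IsSkewDir (dirIter 2 (k + 1) Us (fun y ν => X y ν - gaugeDir Us (spikeW (2 ^ (k + 1)) (framePotW 2 (k + 1) Us X)) y ν)))
        (mu : Site 4 → Matrix n n ℂ), (∀ y, mu y ∈ skewAdjoint (Matrix n n ℂ)) →
        (∀ (y : Site 4) (i : Fin 4), mu (y + ((N * 2 ^ (k + 1) : ℕ) : ℤ) • e i) = mu y) → (∀ w : Site 4, mu ((((2 : ℕ) : ℤ) ^ (k + 1)) • w) = 0) →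
        (fun y ν => (X y ν - (gaugeDir Us (spikeW (2 ^ (k + 1)) (framePotW 2 (k + 1) Us X)) + rightInvW (le_refl 2) k hWu hx0 hsm0 hWx N hθ0 hYs) y ν) + gaugeDir Us mu y ν)
          ∈ frameFreeBlockLandauW (d := 4) (n := n) 2 N (k + 1) Us →
        dirSq (gaugeDir Us mu) (periodBox (d := 4) (N * 2 ^ (k + 1))) ≤ m₂ * (((2 : ℕ) : ℝ) ^ (k + 1)) ^ 2 * energyNormW 2 (k + 1) Us X (periodBox (d := 4) (N * 2 ^ (k + 1))) ^ 2
        ∧ ∑ z ∈ periodBox (d := 4) (N * 2 ^ (k + 1)), ‖mu z‖ ^ 2 ≤ p₂ * (((2 : ℕ) : ℝ) ^ (k + 1)) ^ 4 * energyNormW 2 (k + 1) Us X (periodBox (d := 4) (N * 2 ^ (k + 1))) ^ 2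
        ∧ ∑ z ∈ periodBox (d := 4) (N * 2 ^ (k + 1)), ‖mu z‖ ≤ m₁ * (((2 : ℕ) : ℝ) ^ (k + 1)) ^ 3 * energyNormW 2 (k + 1) Us X (periodBox (d := 4) (N * 2 ^ (k + 1))) ^ 2)
    {νh κh : ℝ}
    (hνh : 2 * Real.sqrt (((Fintype.card (T4AveragingDeficitWall.Plane 4) : ℝ) + ((4 : ℕ) : ℝ))
            * (8192 * ((((4 : ℕ) : ℝ)) ^ 3 * ((2 : ℕ) : ℝ) ^ 5) * 2 + 2048 * ((((4 : ℕ) : ℝ)) * ((2 : ℕ) : ℝ)) * (C1cov 4 * ((2 : ℕ) : ℝ) ^ 2 * Real.sqrt (((4 : ℕ) : ℝ) * (2 * (2 * ((2 : ℕ) : ℝ)) + 1) ^ 4)) ^ 2 * 1))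
            * αh
          + Real.sqrt ((l2C 4 2 / (1 - thetaLoc 4 2 * ε) ^ 2 + curl2C 4 2 / (1 - thetaLoc 4 2 * ε) ^ 2)
              * (1024 * (C1cov 4 * ((2 : ℕ) : ℝ) ^ 2 * Real.sqrt (((4 : ℕ) : ℝ) * (2 * (2 * ((2 : ℕ) : ℝ)) + 1) ^ 4)) ^ 2 * (((2 : ℕ) : ℝ) ^ 4 / ((2 : ℕ) : ℝ) ^ 4))) * αh
          + Real.sqrt (4 * ε ^ 2 * (Fintype.card (T4AveragingDeficitWall.Plane 4)) * p₂ + m₂) ≤ νh)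
    (hκh : 2 * (Fintype.card (T4AveragingDeficitWall.Plane 4) : ℝ)
            * (16 * ((((4 : ℕ) : ℝ)) * ((2 : ℕ) : ℝ)) * (6 * 2 + 2 * (4 / 3)) + 64 * (C1cov 4 * ((2 : ℕ) : ℝ) ^ 2 * (((4 : ℕ) : ℝ) * (2 * (2 * ((2 : ℕ) : ℝ)) + 1) ^ 4)) * (4 / 3)) * ε ^ 2
          + (curl1C 4 2 / (1 - thetaLoc 4 2 * ε)) * ε * (64 * (C1cov 4 * ((2 : ℕ) : ℝ) ^ 2 * (((4 : ℕ) : ℝ) * (2 * (2 * ((2 : ℕ) : ℝ)) + 1) ^ 4)) * (((2 : ℕ) : ℝ) ^ 4 / ((2 : ℕ) : ℝ) ^ 2))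
          + 2 * (Fintype.card (T4AveragingDeficitWall.Plane 4)) * ε ^ 2 * m₁ ≤ κh) :
    ∃ (u : Site 4 → (Matrix n n ℂ)ˣ) (X XT XN : Site 4 → Fin 4 → Matrix n n ℂ) (α ν κ : ℝ),
      IsUnitarySite u ∧ IsSkewDir X ∧ IsPeriodicDir X ((N * 2 ^ (k + 1) : ℕ) : ℤ) ∧ 0 ≤ α ∧ (∀ x μ, ‖X x μ‖ ≤ α) ∧
      gaugeAct u U' = vary Us X 1 ∧
      X = XT + XN ∧ XT ∈ frameFreeBlockLandauW (d := 4) (n := n) 2 N (k + 1) Us ∧ IsSkewDir XN ∧ 0 ≤ ν ∧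
      energyNormW 2 (k + 1) Us XN (periodBox (d := 4) (N * 2 ^ (k + 1)))
        ≤ ν * energyNormW 2 (k + 1) Us X (periodBox (d := 4) (N * 2 ^ (k + 1))) ∧
      ε / (((2 : ℕ) : ℝ) ^ (k + 1)) ^ 2 * (∑ p ∈ perWin 4 (N * 2 ^ (k + 1)), ‖curl Us XN p‖)
        ≤ κ * energyNormW 2 (k + 1) Us X (periodBox (d := 4) (N * 2 ^ (k + 1))) ^ 2 ∧
      α * ((2 : ℕ) : ℝ) ^ (k + 1) ≤ αh ∧ ν ≤ νh ∧ κ ≤ κh := by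
  -- the radius identities (no `set`: the binder types of `hμ` depend on these terms)
  have hid := radius_identities k ε
  have hM0 : (0 : ℝ) < ((2 : ℕ) : ℝ) ^ (k + 1) := by positivity
  have hx0 : 0 ≤ ε / (((2 : ℕ) : ℝ) ^ (k + 1)) ^ 2 := by positivity
  have hsm0 : LevelSmall 4 2 k (ε / (((2 : ℕ) : ℝ) ^ (k + 1)) ^ 2) := levelSmall_d4_L2 hε.le hε11 k
  have hθl0 : thetaLoc 4 2 * ((((2 : ℕ) : ℝ) ^ (k + 1)) ^ 2 * (ε / (((2 : ℕ) : ℝ) ^ (k + 1)) ^ 2)) < 1 := by rw [hid.2]; exact hεθ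
  have hθ0 : cruxC 4 2 * ((((2 : ℕ) : ℝ) ^ (k + 1)) ^ 2 * (ε / (((2 : ℕ) : ℝ) ^ (k + 1)) ^ 2)) < 1 := theta_lt_one_of_loc (d := 4) k hx0 hθl0
  have hε1 : (((2 : ℕ) : ℝ) ^ (k + 1)) ^ 2 * (ε / (((2 : ℕ) : ℝ) ^ (k + 1)) ^ 2) ≤ 1 := by
    rw [hid.2]; norm_num at hε11; linarith
  have hMb : 0 ≤ ((2 : ℕ) : ℝ) ^ (k + 1) * b := by positivity
  have hαh0 : 0 ≤ αh := hMb.trans hbα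
  -- the decomposition with all regime binders discharged
  obtain ⟨XT, XN, ν, κ, hXeq, hTmem, hNs, hν0, hN1, hN2, hνeq, hκeq⟩ :=
    decomp_of_topNormalised (d := 4) (L := 2) (N := N) (le_refl 2) (by norm_num) hN k (W := Us) (UA := U') (D := D) (u := u)
      (x := ε / (((2 : ℕ) : ℝ) ^ (k + 1)) ^ 2)
      hWu hWP hx0 hsm0 hWx hθ0 hθl0 hε1 (α₀ := 2 * ε) (b := b) (by positivity) hεC0 hεc2
      (by
        have h1 := pdev_le_of_smallField' hx0 hWx
        have h2 : ε / (((2 : ℕ) : ℝ) ^ (k + 1)) ^ 2 < 2 * ε * ((((2 : ℕ) : ℝ) ^ (k + 1))⁻¹) ^ 2 := by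
          rw [inv_pow, ← div_eq_mul_inv]
          exact div_lt_div_of_pos_right (by linarith) (by positivity)
        exact lt_of_le_of_lt h1 h2)
      hb hX hXP hXs
      (by
        refine exp_line (by positivity) ?_ (by positivity) ?_
        · norm_num at hε11 ⊢; nlinarith
        · have h : 8 * (131072 * (((4 : ℕ) : ℝ) + 1) ^ 2) * (((2 : ℕ) : ℝ) ^ (k + 1) * b) ≤ 8 * (131072 * (((4 : ℕ) : ℝ) + 1) ^ 2) * αh :=
            mul_le_mul_of_nonneg_left hbα (by positivity)
          exact h.trans hαh1)
      (by linarith [hbα, hαh2])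
      (by
        have hK0 : 0 ≤ 16 * (C1cov 4 * ((2 : ℕ) : ℝ) ^ 2 * Real.sqrt (((4 : ℕ) : ℝ) * (2 * (2 * ((2 : ℕ) : ℝ)) + 1) ^ 4)) := by
          have := C1cov_pos 4; positivity
        have h : 16 * (C1cov 4 * ((2 : ℕ) : ℝ) ^ 2 * Real.sqrt (((4 : ℕ) : ℝ) * (2 * (2 * ((2 : ℕ) : ℝ)) + 1) ^ 4)) * ((2 : ℕ) : ℝ) ^ (k + 1) * b
            = 16 * (C1cov 4 * ((2 : ℕ) : ℝ) ^ 2 * Real.sqrt (((4 : ℕ) : ℝ) * (2 * (2 * ((2 : ℕ) : ℝ)) + 1) ^ 4)) * (((2 : ℕ) : ℝ) ^ (k + 1) * b) := by ring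
        rw [h]
        exact (mul_le_mul_of_nonneg_left hbα hK0).trans hαh3)
      (by
        have hr := radSum_d4_L2_le hε.le hε11 k
        have hC : 0 ≤ 16 * (((4 : ℕ) : ℝ) + 1) * (((4 : ℕ) : ℝ) + 4) * ((2 : ℕ) : ℝ) ^ 2 * Csup 4 2 * (((4 : ℕ) : ℝ) * (2 * ((nbRad 4 2 : ℕ) : ℝ) + 1) ^ 4) := by
          have := Csup_nonneg 4 2; positivity
        exact (mul_le_mul_of_nonneg_left hr hC).trans hεS1)
      (by
        calc 44 * ((((4 : ℕ) : ℝ)) * ((2 : ℕ) : ℝ) * (((2 : ℕ) : ℝ) ^ (k + 1) * b))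
            = 44 * (((4 : ℕ) : ℝ) * ((2 : ℕ) : ℝ)) * (((2 : ℕ) : ℝ) ^ (k + 1) * b) := by ring
          _ ≤ 44 * (((4 : ℕ) : ℝ) * ((2 : ℕ) : ℝ)) * αh := mul_le_mul_of_nonneg_left hbα (by positivity)
          _ = 44 * (((4 : ℕ) : ℝ) * ((2 : ℕ) : ℝ) * αh) := by ring
          _ ≤ 1 := hαh4)
      hrep hcorner hA hW hv1 (Γ₁ := 2) (Γ₂ := 1) (Γ₃ := 4 / 3) (Γ₄ := 4 / 3) (ceiling_one k) (ceiling_two k) (ceiling_three k) (ceiling_four k)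
      hm₂ hp₂ hm₁ (fun hYs mu h1 h2 h3 h4 => hμ hx0 hsm0 hθ0 hYs mu h1 h2 h3 h4)
  -- the currencies
  rw [hid.2] at hνeq hκeq
  have key : ∀ {A B C : ℝ}, 0 ≤ A → 0 ≤ B → A * αh + B * αh + C ≤ νh →
      A * (((2 : ℕ) : ℝ) ^ (k + 1) * b) + B * (((2 : ℕ) : ℝ) ^ (k + 1) * b) + C ≤ νh := by
    intro A B C hA hB h
    have h1 := mul_le_mul_of_nonneg_left hbα hA
    have h2 := mul_le_mul_of_nonneg_left hbα hB
    linarith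
  refine ⟨u, X, XT, XN, b, ν, κ, hu, hXs, hXP, hb, hX, hrep, hXeq, hTmem, hNs, hν0, hN1, hN2, ?_, ?_, ?_⟩
  · rw [mul_comm]; exact hbα
  · rw [hνeq]
    exact key (by positivity) (by positivity) hνh
  · rw [hκeq]; exact hκh

end

end Summit.QuantumFields.BalabanUV.T4Continuum.NE7HdecompOfTopNormalised
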